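import Summits.Ventures.YMGap.RobustBall.HeatBathPoincareZdDLR
import Summits.Ventures.YMGap.Thresholds.ImprovedThresholdSU3PV2
import Literature.MathematicalPhysics.QuantumFieldTheory.Balaban1983to89.StrongCouplingKernelWindow
import HarnessLib

/-!
# Robust ball (Y2) — heat-bath Poincaré inequality of every infinite-volume Gibbs state: every-`SU(N)` and `SU(3)` hypothesis-free cells

HONEST FRAMING: venture file of the cell `pub-ymgap` (QuantumFields programme), track ROBUST-BALL, seat rb-p2 (g12); cells of
`HeatBathPoincareZd.gibbsVariance_le_of_oneLinkKRModulus` (the single-link heat-bath / Glauber Poincaré inequality of EVERY DLR state of `SU(N)`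
lattice Yang–Mills on `ℤ⁴` for local Lipschitz observables, from a one-link Kantorovich–Rubinstein modulus).  LATTICE statements at strong coupling;
nothing about `β → ∞`, the continuum or Clay.
* `suN_gibbsVariance_le_bakryEmery` — EVERY `N ≥ 2`, HYPOTHESIS-FREE on Shen–Zhu–Zhu's printed window 't Hooft `0 ≤ b < 1/48` (bare coupling `N b`;
  Bakry–Émery modulus `StrongCouplingKernelWindow.oneLinkKRModulus_SU`, `K = 1/(1/2 − 6b)`): constant `(2(1 − 18b/(1/2 − 6b)))⁻¹`.
* `su3_gibbsVariance_le_pv2` — `SU(3)`, HYPOTHESIS-FREE on `0 ≤ β_W < 625/2679 ≈ 0.233` (tree coupling `β_W/3`; engine-2's certified modulus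
  `OneLinkVarianceSDC.su3_oneLinkKRModulus_pv2_oneFifth`): constant `(2(1 − 2679β_W/625))⁻¹`.
* `suN_kernelVariance_le_bakryEmery`, `su3_kernelVariance_le_pv2` — the same cells for the kernel inequality (finite volumes of `ℤ⁴`, every boundary field).
* `su2_kernelVariance_le_dim3`, `su2_gibbsVariance_le_dim3` — `SU(2)`, `d = 3`, HYPOTHESIS-FREE on `0 ≤ β_W < 1/3`, constant `(2 − 6β_W)⁻¹`.
-/

noncomputable section

open MeasureTheory Function
open scoped NNReal
open Literature.MathematicalPhysics.QuantumLattice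
open Literature.MathematicalPhysics.QuantumFieldTheory hiding ZdEdge
open Literature.MathematicalPhysics.QuantumFieldTheory.Balaban1983to89

namespace Summit.Ventures.YMGap.RobustBall.HeatBathPoincareZd

variable {N : ℕ}

/-- ★★★ **EVERY `SU(N)`, `N ≥ 2`, `d = 4`, HYPOTHESIS-FREE (Bakry–Émery modulus): the heat-bath Poincaré inequality of EVERY infinite-volume Gibbs state
on Shen–Zhu–Zhu's printed window 't Hooft `0 ≤ b < 1/48`** (bare coupling `N b`): for every DLR state `μ` and every Lipschitz cylinder `F` on `Δ`,
`Var_μ(F) ≤ (2(1 − 18b/(1/2 − 6b)))⁻¹ ∑_{x ∈ Δ} ∫ (∫ (F(U) − F(σ))² γ_{x}(dσ|U)) μ(dU)`. [folklore] -/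
theorem suN_gibbsVariance_le_bakryEmery (hN : 2 ≤ N) {b : ℝ} (hb0 : 0 ≤ b) (hb : b < 1 / 48)
    {μ : Measure (LGConfig 4 (Matrix.specialUnitaryGroup (Fin N) ℂ))}
    (hμ : μ ∈ ymGibbsMeasures (d := 4) (fundamentalRep (Fin N)) ((N : ℝ) * b))
    {F : LGConfig 4 (Matrix.specialUnitaryGroup (Fin N) ℂ) → ℝ} {Δ : Finset (ZdEdge 4)} {KF : ℝ≥0}
    (hF : IsLipschitzCylinder (fundamentalRep (Fin N)) F Δ KF) :
    ProbabilityTheory.variance F μ ≤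
      (2 * (1 - 18 * b / (1 / 2 - 6 * b)))⁻¹ *
        ∑ x ∈ Δ, ∫ U, ∫ σ, (F U - F σ) ^ 2 ∂(ymSpecification (fundamentalRep (Fin N)) ((N : ℝ) * b) {x} U) ∂μ := by
  have habs : |b| = b := abs_of_nonneg hb0
  have hR : 6 * b < 1 / 2 := by linarith
  have hden : 0 < 1 / 2 - 6 * b := by linarith
  have hK : (0 : ℝ) ≤ 1 / (1 / 2 - 6 * b) := by positivity
  have hc1 : 18 * b / (1 / 2 - 6 * b) < 1 := by rw [div_lt_one hden]; linarith
  refine gibbsVariance_le_of_oneLinkKRModulus (d := 4) (N := N) (by norm_num) (by omega) (β := b) hK (R := 6 * b) ?_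
    (StrongCouplingKernelWindow.oneLinkKRModulus_SU hN hR) (c := 18 * b / (1 / 2 - 6 * b)) ?_ hc1 hμ hF
  · rw [habs]; norm_num; linarith
  · rw [habs]; norm_num; exact le_of_eq (by field_simp)

/-- ★★★ **`SU(3)`, `d = 4`, HYPOTHESIS-FREE (certified PV2 modulus `OneLinkKRModulus 3 (1/5) (2679/1250)`): the heat-bath Poincaré inequality of EVERY
infinite-volume Gibbs state on `0 ≤ β_W < 625/2679 ≈ 0.233`** (tree coupling `β_W/3`): for every DLR state `μ` and every Lipschitz cylinder `F` on `Δ`,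
`Var_μ(F) ≤ (2(1 − 2679β_W/625))⁻¹ ∑_{x ∈ Δ} ∫ (∫ (F(U) − F(σ))² γ_{x}(dσ|U)) μ(dU)`. [folklore] -/
theorem su3_gibbsVariance_le_pv2 {βW : ℝ} (h0 : 0 ≤ βW) (h : βW < 625 / 2679)
    {μ : Measure (LGConfig 4 (Matrix.specialUnitaryGroup (Fin 3) ℂ))}
    (hμ : μ ∈ ymGibbsMeasures (d := 4) (fundamentalRep (Fin 3)) (βW / 3))
    {F : LGConfig 4 (Matrix.specialUnitaryGroup (Fin 3) ℂ) → ℝ} {Δ : Finset (ZdEdge 4)} {KF : ℝ≥0}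
    (hF : IsLipschitzCylinder (fundamentalRep (Fin 3)) F Δ KF) :
    ProbabilityTheory.variance F μ ≤
      (2 * (1 - 2679 * βW / 625))⁻¹ *
        ∑ x ∈ Δ, ∫ U, ∫ σ, (F U - F σ) ^ 2 ∂(ymSpecification (fundamentalRep (Fin 3)) (βW / 3) {x} U) ∂μ := by
  have hβ : ((3 : ℕ) : ℝ) * (βW / 9) = βW / 3 := by push_cast; ring
  have habs : |βW / 9| = βW / 9 := abs_of_nonneg (by positivity)
  have hμ9 : μ ∈ ymGibbsMeasures (d := 4) (fundamentalRep (Fin 3)) ((3 : ℕ) * (βW / 9)) := by rwa [hβ]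
  have key := gibbsVariance_le_of_oneLinkKRModulus (d := 4) (N := 3) (by norm_num) (by norm_num) (β := βW / 9) (by norm_num) (R := 1 / 5)
    (by rw [habs]; norm_num; linarith) OneLinkVarianceSDC.su3_oneLinkKRModulus_pv2_oneFifth (c := 2679 * βW / 625)
    (by rw [habs]; norm_num; linarith) (by rw [div_lt_one (by norm_num)]; linarith) hμ9 hF
  rw [hβ] at key
  exact key

/-! ### The kernel versions (finite volumes of `ℤ⁴` with boundary fields) -/

/-- ★★ **EVERY `SU(N)`, `N ≥ 2`, `d = 4`, 't Hooft `0 ≤ b < 1/48`, HYPOTHESIS-FREE**: the kernel Poincaré inequality of every non-empty finite volume of `ℤ⁴`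
with every boundary field, constant `(2(1 − 18b/(1/2 − 6b)))⁻¹`. [folklore] -/
theorem suN_kernelVariance_le_bakryEmery (hN : 2 ≤ N) {b : ℝ} (hb0 : 0 ≤ b) (hb : b < 1 / 48) {V : Finset (ZdEdge 4)} (hV : V.Nonempty)
    (η : LGConfig 4 (Matrix.specialUnitaryGroup (Fin N) ℂ)) {F : LGConfig 4 (Matrix.specialUnitaryGroup (Fin N) ℂ) → ℝ}
    (hF : Measurable F) (hFb : ∃ M : ℝ, ∀ U, |F U| ≤ M) :
    ProbabilityTheory.variance F (ymSpecification (fundamentalRep (Fin N)) ((N : ℝ) * b) V η) ≤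
      (2 * (1 - 18 * b / (1 / 2 - 6 * b)))⁻¹ *
        ∑ x ∈ V, ∫ U, ∫ σ, (F U - F σ) ^ 2 ∂(ymSpecification (fundamentalRep (Fin N)) ((N : ℝ) * b) {x} U)
          ∂(ymSpecification (fundamentalRep (Fin N)) ((N : ℝ) * b) V η) := by
  have habs : |b| = b := abs_of_nonneg hb0
  have hR : 6 * b < 1 / 2 := by linarith
  have hden : 0 < 1 / 2 - 6 * b := by linarith
  have hK : (0 : ℝ) ≤ 1 / (1 / 2 - 6 * b) := by positivity
  have hc1 : 18 * b / (1 / 2 - 6 * b) < 1 := by rw [div_lt_one hden]; linarith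
  refine kernelVariance_le_of_oneLinkKRModulus (d := 4) (N := N) (by norm_num) (by omega) (β := b) hK (R := 6 * b) ?_
    (StrongCouplingKernelWindow.oneLinkKRModulus_SU hN hR) (c := 18 * b / (1 / 2 - 6 * b)) ?_ hc1 hV η hF hFb
  · rw [habs]; norm_num; linarith
  · rw [habs]; norm_num; exact le_of_eq (by field_simp)

/-- ★★ **`SU(3)`, `d = 4`, `0 ≤ β_W < 625/2679`, HYPOTHESIS-FREE (PV2 certificate)**: the kernel Poincaré inequality of every non-empty finite volume of
`ℤ⁴` with every boundary field at tree coupling `β_W/3`, constant `(2(1 − 2679β_W/625))⁻¹`. [folklore] -/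
theorem su3_kernelVariance_le_pv2 {βW : ℝ} (h0 : 0 ≤ βW) (h : βW < 625 / 2679) {V : Finset (ZdEdge 4)} (hV : V.Nonempty)
    (η : LGConfig 4 (Matrix.specialUnitaryGroup (Fin 3) ℂ)) {F : LGConfig 4 (Matrix.specialUnitaryGroup (Fin 3) ℂ) → ℝ}
    (hF : Measurable F) (hFb : ∃ M : ℝ, ∀ U, |F U| ≤ M) :
    ProbabilityTheory.variance F (ymSpecification (fundamentalRep (Fin 3)) (βW / 3) V η) ≤
      (2 * (1 - 2679 * βW / 625))⁻¹ *
        ∑ x ∈ V, ∫ U, ∫ σ, (F U - F σ) ^ 2 ∂(ymSpecification (fundamentalRep (Fin 3)) (βW / 3) {x} U)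
          ∂(ymSpecification (fundamentalRep (Fin 3)) (βW / 3) V η) := by
  have hβ : ((3 : ℕ) : ℝ) * (βW / 9) = βW / 3 := by push_cast; ring
  have habs : |βW / 9| = βW / 9 := abs_of_nonneg (by positivity)
  have key := kernelVariance_le_of_oneLinkKRModulus (d := 4) (N := 3) (by norm_num) (by norm_num) (β := βW / 9) (by norm_num) (R := 1 / 5)
    (by rw [habs]; norm_num; linarith) OneLinkVarianceSDC.su3_oneLinkKRModulus_pv2_oneFifth (c := 2679 * βW / 625)
    (by rw [habs]; norm_num; linarith) (by rw [div_lt_one (by norm_num)]; linarith) hV η hF hFb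
  rw [hβ] at key
  exact key

/-! ### `SU(2)` in three dimensions: the window `β_W < 1/3` -/

section Dim3

/-- **`SU(2)`, `d = 3`, HYPOTHESIS-FREE on `0 ≤ β_W < 1/3`** (tree coupling `β_W/2`, quarter modulus; column sum `6(d−1)|β| K = 3β_W`): the kernel
Poincaré inequality of every non-empty finite volume of `ℤ³` with every boundary field, constant `(2 − 6β_W)⁻¹`. [folklore] -/
theorem su2_kernelVariance_le_dim3 {βW : ℝ} (h0 : 0 ≤ βW) (h : βW < 1 / 3) {V : Finset (ZdEdge 3)} (hV : V.Nonempty)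
    (η : LGConfig 3 (Matrix.specialUnitaryGroup (Fin 2) ℂ)) {F : LGConfig 3 (Matrix.specialUnitaryGroup (Fin 2) ℂ) → ℝ}
    (hF : Measurable F) (hFb : ∃ M : ℝ, ∀ U, |F U| ≤ M) :
    ProbabilityTheory.variance F (ymSpecification (fundamentalRep (Fin 2)) (βW / 2) V η) ≤
      (2 - 6 * βW)⁻¹ * ∑ x ∈ V, ∫ U, ∫ σ, (F U - F σ) ^ 2 ∂(ymSpecification (fundamentalRep (Fin 2)) (βW / 2) {x} U)
        ∂(ymSpecification (fundamentalRep (Fin 2)) (βW / 2) V η) := by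
  have hβ : ((2 : ℕ) : ℝ) * (βW / 4) = βW / 2 := by push_cast; ring
  have habs : |βW / 4| = βW / 4 := abs_of_nonneg (by positivity)
  have key := kernelVariance_le_of_oneLinkKRModulus (d := 3) (N := 2) (by norm_num) (by norm_num) (β := βW / 4) (R := βW)
    zero_le_one (by rw [habs]; norm_num) (SlabAreaLawDimensions.su2_oneLinkKRModulus_of_le_one (by linarith)) (c := 3 * βW)
    (by rw [habs]; norm_num; linarith) (by linarith) hV η hF hFb
  have e : (2 * (1 - 3 * βW))⁻¹ = (2 - 6 * βW)⁻¹ := by congr 1; ring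
  rw [hβ, e] at key
  exact key

/-- **`SU(2)`, `d = 3`, HYPOTHESIS-FREE on `0 ≤ β_W < 1/3`**: the heat-bath Poincaré inequality of EVERY DLR state of 3D `SU(2)` lattice Yang–Mills for
Lipschitz cylinders, constant `(2 − 6β_W)⁻¹`. [folklore] -/
theorem su2_gibbsVariance_le_dim3 {βW : ℝ} (h0 : 0 ≤ βW) (h : βW < 1 / 3)
    {μ : Measure (LGConfig 3 (Matrix.specialUnitaryGroup (Fin 2) ℂ))}
    (hμ : μ ∈ ymGibbsMeasures (d := 3) (fundamentalRep (Fin 2)) (βW / 2))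
    {F : LGConfig 3 (Matrix.specialUnitaryGroup (Fin 2) ℂ) → ℝ} {Δ : Finset (ZdEdge 3)} {KF : ℝ≥0}
    (hF : IsLipschitzCylinder (fundamentalRep (Fin 2)) F Δ KF) :
    ProbabilityTheory.variance F μ ≤
      (2 - 6 * βW)⁻¹ * ∑ x ∈ Δ, ∫ U, ∫ σ, (F U - F σ) ^ 2 ∂(ymSpecification (fundamentalRep (Fin 2)) (βW / 2) {x} U) ∂μ := by
  have hβ : ((2 : ℕ) : ℝ) * (βW / 4) = βW / 2 := by push_cast; ring
  have habs : |βW / 4| = βW / 4 := abs_of_nonneg (by positivity)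
  have hμ4 : μ ∈ ymGibbsMeasures (d := 3) (fundamentalRep (Fin 2)) ((2 : ℕ) * (βW / 4)) := by rwa [hβ]
  have key := gibbsVariance_le_of_oneLinkKRModulus (d := 3) (N := 2) (by norm_num) (by norm_num) (β := βW / 4) (R := βW)
    zero_le_one (by rw [habs]; norm_num) (SlabAreaLawDimensions.su2_oneLinkKRModulus_of_le_one (by linarith)) (c := 3 * βW)
    (by rw [habs]; norm_num; linarith) (by linarith) hμ4 hF
  have e : (2 * (1 - 3 * βW))⁻¹ = (2 - 6 * βW)⁻¹ := by congr 1; ring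
  rw [hβ, e] at key
  exact key

end Dim3

end Summit.Ventures.YMGap.RobustBall.HeatBathPoincareZd

end
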